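import Literature.MathematicalPhysics.QuantumLattice.HubbardEffectiveActionCT

/-!
# Line `seed-strength-flow` (crux stmt-HubbardSuperconductivity-14047): stubs S1, S2, S3 PROVED

Refuter `refuter-drefute-stmt-HubbardSuperconductivity-14047-0` (drefute, 2026-08-16).  Candidate proofs of the
three model-level stubs of `Cruxes/SeededBrokenRegimeBoseFermiPinned/Lines/seed-strength-flow.lean`, statements
BYTE-IDENTICAL with the skeleton's `stub_seedSliceBound` (S1), `stub_seedConvolution` (S2),
`stub_seedSliceCovarianceBound` (S3, with S1 as hypothesis as filed) plus the unconditional corollary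
`stub_seedSliceCovarianceBound_unconditional`.  `lean check` rc 0, 0 sorry, axioms ⊆ {propext, Classical.choice,
Quot.sound}.  NOT landed (positive results are a prover's landing); attached as item evidence.

* S1: off-diagonal `|∂_h G₁₂| = |φ|·|D − x²|/(D + x²)² ≤ |φ|/D`, diagonal `|∂_h G₁₁| = 2√D|x||φ|/(D + x²)² ≤ |φ|/D`
  since `(s² + y²)² − 2s³y = s²(s − y)² + s²y² + y⁴ ≥ 0` (`D = ω² + e_K² ≥ Λ²`, `x = hφ`).
* S2: `C_h = (C_h − C_h₀) + C_h₀` and `effAction_add` (needs only `Z_h₀` a unit; no antisymmetry).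
* S3: `ΔC^{>Λ₀}(X,Y) = ½(w_X + w_Y)·ΔC(X,Y)`, `½(w_X + w_Y) ∈ [0,1]` nonzero only if `ω² + e_K² > Λ₀²/4` at the
  common momentum; S1 at `Λ = Λ₀/2` + mean-value inequality: `‖ΔG_ab‖ ≤ 4|φ_d||h − h₀|/Λ₀² ≤ 16√2|h − h₀|/Λ₀²`
  (`|φ_d| ≤ 4√2`), times `βL²`, times the two orders of the antisymmetrised table: `32√2`.  (The sharp
  constant is `16√2`: the two orders are mutually exclusive.)
-/

noncomputable section

set_option linter.dupNamespace false

namespace Summit.HubbardSuperconductivity.HubbardSuperconductivity.Cruxes.SeededBrokenRegimeBoseFermiPinned.Drefute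

open Literature.MathematicalPhysics.QuantumLattice Literature.Probability.LatticeModels GrassmannAlgebra

/-! ### S1 -/

/-- `d/dh (D + (hφ)²) = 2hφ²`. -/
theorem hasDerivAt_den (D φ h : ℝ) :
    HasDerivAt (fun h' : ℝ => D + (h' * φ) ^ 2) (2 * h * φ ^ 2) h := by
  have h1 : HasDerivAt (fun h' : ℝ => h' * φ) φ h := by
    simpa using (hasDerivAt_id h).mul_const φ
  have h2 := (h1.fun_pow 2).const_add D
  refine h2.congr_deriv ?_
  norm_num
  ring

/-- The same, complex-valued. -/
theorem hasDerivAt_den_complex (D φ h : ℝ) :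
    HasDerivAt (fun h' : ℝ => (((D + (h' * φ) ^ 2 : ℝ)) : ℂ)) (((2 * h * φ ^ 2 : ℝ)) : ℂ) h :=
  (hasDerivAt_den D φ h).ofReal_comp

/-- Diagonal entries `c / (D + (hφ)²)`. -/
theorem hasDerivAt_diag (c : ℂ) (D φ h : ℝ) (hD : 0 < D) :
    HasDerivAt (fun h' : ℝ => c / (((D + (h' * φ) ^ 2 : ℝ)) : ℂ))
      (-(c * ((2 * h * φ ^ 2 : ℝ) : ℂ)) / (((D + (h * φ) ^ 2 : ℝ)) : ℂ) ^ 2) h := by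
  have hne : (((D + (h * φ) ^ 2 : ℝ)) : ℂ) ≠ 0 := by
    have : 0 < D + (h * φ) ^ 2 := by positivity
    exact_mod_cast this.ne'
  exact ((hasDerivAt_const h c).fun_div (hasDerivAt_den_complex D φ h) hne).congr_deriv (by ring)

/-- Off-diagonal entries `hφ / (D + (hφ)²)`. -/
theorem hasDerivAt_offDiag (D φ h : ℝ) (hD : 0 < D) :
    HasDerivAt (fun h' : ℝ => (((h' * φ : ℝ)) : ℂ) / (((D + (h' * φ) ^ 2 : ℝ)) : ℂ))
      ((((φ : ℝ) : ℂ) * (((D + (h * φ) ^ 2 : ℝ)) : ℂ) - ((h * φ : ℝ) : ℂ) * ((2 * h * φ ^ 2 : ℝ) : ℂ)) /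
        (((D + (h * φ) ^ 2 : ℝ)) : ℂ) ^ 2) h := by
  have hne : (((D + (h * φ) ^ 2 : ℝ)) : ℂ) ≠ 0 := by
    have : 0 < D + (h * φ) ^ 2 := by positivity
    exact_mod_cast this.ne'
  have hnum : HasDerivAt (fun h' : ℝ => (((h' * φ : ℝ)) : ℂ)) ((φ : ℝ) : ℂ) h := by
    have h1 : HasDerivAt (fun h' : ℝ => h' * φ) φ h := by
      simpa using (hasDerivAt_id h).mul_const φ
    exact h1.ofReal_comp
  exact hnum.fun_div (hasDerivAt_den_complex D φ h) hne

/-- Bound for the diagonal derivative: `‖c‖² = D ≥ Λ²` gives `‖c‖·2|h|φ²/(D + (hφ)²)² ≤ |φ|/Λ²`. -/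
theorem diag_bound (c : ℂ) (D φ h Λ : ℝ) (hΛ : 0 < Λ) (hD : Λ ^ 2 ≤ D) (hc : ‖c‖ ^ 2 = D) :
    ‖-(c * ((2 * h * φ ^ 2 : ℝ) : ℂ)) / (((D + (h * φ) ^ 2 : ℝ)) : ℂ) ^ 2‖ ≤ |φ| / Λ ^ 2 := by
  have hDpos : 0 < D := lt_of_lt_of_le (by positivity) hD
  have hden : 0 < D + (h * φ) ^ 2 := by positivity
  rw [norm_div, norm_neg, norm_mul, norm_pow, Complex.norm_real, Complex.norm_real, Real.norm_eq_abs,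
    Real.norm_eq_abs, abs_of_pos hden]
  set s := ‖c‖ with hs
  have hs0 : 0 ≤ s := norm_nonneg _
  have habs : |2 * h * φ ^ 2| = 2 * |h| * φ ^ 2 := by
    rw [abs_mul, abs_mul, abs_of_pos two_pos, abs_of_nonneg (sq_nonneg φ)]
  rw [habs, div_le_div_iff₀ (by positivity) (by positivity)]
  set y := |h| * |φ| with hy
  have hy0 : 0 ≤ y := by positivity
  have hy2 : y ^ 2 = (h * φ) ^ 2 := by rw [hy, mul_pow, sq_abs, sq_abs, mul_pow]
  have key : 2 * s ^ 3 * y ≤ (s ^ 2 + y ^ 2) ^ 2 := by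
    nlinarith [mul_nonneg (sq_nonneg s) (sq_nonneg (s - y)), mul_nonneg (sq_nonneg s) (sq_nonneg y),
      sq_nonneg (y ^ 2)]
  calc s * (2 * |h| * φ ^ 2) * Λ ^ 2 = 2 * s * y * |φ| * Λ ^ 2 := by rw [hy, ← sq_abs φ]; ring
    _ ≤ 2 * s * y * |φ| * s ^ 2 := mul_le_mul_of_nonneg_left (hD.trans_eq hc.symm) (by positivity)
    _ = |φ| * (2 * s ^ 3 * y) := by ring
    _ ≤ |φ| * (s ^ 2 + y ^ 2) ^ 2 := mul_le_mul_of_nonneg_left key (abs_nonneg _)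
    _ = |φ| * (D + (h * φ) ^ 2) ^ 2 := by rw [hc, hy2]

/-- Bound for the off-diagonal derivative: `|φ|·|D − (hφ)²|/(D + (hφ)²)² ≤ |φ|/D ≤ |φ|/Λ²`. -/
theorem offDiag_bound (D φ h Λ : ℝ) (hΛ : 0 < Λ) (hD : Λ ^ 2 ≤ D) :
    ‖((((φ : ℝ) : ℂ) * (((D + (h * φ) ^ 2 : ℝ)) : ℂ) - ((h * φ : ℝ) : ℂ) * ((2 * h * φ ^ 2 : ℝ) : ℂ)) /
        (((D + (h * φ) ^ 2 : ℝ)) : ℂ) ^ 2)‖ ≤ |φ| / Λ ^ 2 := by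
  have hDpos : 0 < D := lt_of_lt_of_le (by positivity) hD
  have hden : 0 < D + (h * φ) ^ 2 := by positivity
  have hnum : ((φ : ℝ) : ℂ) * (((D + (h * φ) ^ 2 : ℝ)) : ℂ) - ((h * φ : ℝ) : ℂ) * ((2 * h * φ ^ 2 : ℝ) : ℂ)
      = ((φ * (D - (h * φ) ^ 2) : ℝ) : ℂ) := by
    push_cast; ring
  rw [hnum, norm_div, norm_pow, Complex.norm_real, Complex.norm_real, Real.norm_eq_abs, Real.norm_eq_abs,
    abs_of_pos hden, abs_mul, div_le_div_iff₀ (by positivity) (by positivity)]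
  have h1 : |D - (h * φ) ^ 2| ≤ D + (h * φ) ^ 2 := by
    rw [abs_le]; constructor <;> nlinarith [sq_nonneg (h * φ), hDpos]
  have h2 : Λ ^ 2 ≤ D + (h * φ) ^ 2 := by nlinarith [sq_nonneg (h * φ)]
  calc |φ| * |D - (h * φ) ^ 2| * Λ ^ 2 ≤ |φ| * (D + (h * φ) ^ 2) * (D + (h * φ) ^ 2) :=
        mul_le_mul (mul_le_mul_of_nonneg_left h1 (abs_nonneg _)) h2 (by positivity) (by positivity)
    _ = |φ| * (D + (h * φ) ^ 2) ^ 2 := by ring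

/-- `‖iω + e‖² = ω² + e²` and `‖iω − e‖² = ω² + e²`. -/
theorem norm_sq_I_mul_add (ω e : ℝ) : ‖Complex.I * ω + e‖ ^ 2 = ω ^ 2 + e ^ 2 := by
  rw [Complex.sq_norm, Complex.normSq_apply]
  simp
  ring

theorem norm_sq_I_mul_sub (ω e : ℝ) : ‖Complex.I * ω - e‖ ^ 2 = ω ^ 2 + e ^ 2 := by
  rw [Complex.sq_norm, Complex.normSq_apply]
  simp
  ring

/-- **S1 (`stub_seedSliceBound`), proved.** -/
theorem stub_seedSliceBound_proof :
    ∀ (L M : ℕ) [NeZero L] (β μ Λ h : ℝ) (K : TrigPolyC4v) (k : FreqMomentum L M) (i j : Fin 2),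
      0 < Λ → Λ ^ 2 ≤ matsubaraFreq β M k.1 ^ 2 + nambuXiCT L μ K k.2 ^ 2 →
        DifferentiableAt ℝ (fun h' : ℝ => nambuPropagatorCT L M β μ h' K k i j) h ∧
        ‖deriv (fun h' : ℝ => nambuPropagatorCT L M β μ h' K k i j) h‖ ≤ |dWaveSymbol L k.2| / Λ ^ 2 := by
  intro L M _ β μ Λ h K k i j hΛ hD
  set ω := matsubaraFreq β M k.1 with hω
  set e := nambuXiCT L μ K k.2 with he
  set φ := dWaveSymbol L k.2 with hφ
  set D := ω ^ 2 + e ^ 2 with hD'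
  have hDpos : 0 < D := lt_of_lt_of_le (by positivity) hD
  have hden : ∀ h' : ℝ, (nambuDenCT L M β μ h' K k : ℂ) = (((D + (h' * φ) ^ 2 : ℝ)) : ℂ) := fun h' => rfl
  fin_cases i <;> fin_cases j
  · -- (0,0): (iω + e)/den
    show DifferentiableAt ℝ (fun h' : ℝ => nambuPropagatorCT L M β μ h' K k 0 0) h ∧
      ‖deriv (fun h' : ℝ => nambuPropagatorCT L M β μ h' K k 0 0) h‖ ≤ |φ| / Λ ^ 2
    have H : HasDerivAt (fun h' : ℝ => nambuPropagatorCT L M β μ h' K k 0 0)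
        (-((Complex.I * ω + e) * ((2 * h * φ ^ 2 : ℝ) : ℂ)) / (((D + (h * φ) ^ 2 : ℝ)) : ℂ) ^ 2) h := by
      convert hasDerivAt_diag (Complex.I * ω + e) D φ h hDpos using 1
      funext h'
      rw [← hden h']
      simp [nambuPropagatorCT, hω, he]
    refine ⟨H.differentiableAt, ?_⟩
    rw [H.deriv]
    exact diag_bound _ D φ h Λ hΛ hD (norm_sq_I_mul_add ω e)
  · -- (0,1): hφ/den
    show DifferentiableAt ℝ (fun h' : ℝ => nambuPropagatorCT L M β μ h' K k 0 1) h ∧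
      ‖deriv (fun h' : ℝ => nambuPropagatorCT L M β μ h' K k 0 1) h‖ ≤ |φ| / Λ ^ 2
    have H : HasDerivAt (fun h' : ℝ => nambuPropagatorCT L M β μ h' K k 0 1)
        ((((φ : ℝ) : ℂ) * (((D + (h * φ) ^ 2 : ℝ)) : ℂ) - ((h * φ : ℝ) : ℂ) * ((2 * h * φ ^ 2 : ℝ) : ℂ)) /
          (((D + (h * φ) ^ 2 : ℝ)) : ℂ) ^ 2) h := by
      convert hasDerivAt_offDiag D φ h hDpos using 1
      funext h'
      rw [← hden h']
      simp [nambuPropagatorCT, hφ]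
    refine ⟨H.differentiableAt, ?_⟩
    rw [H.deriv]
    exact offDiag_bound D φ h Λ hΛ hD
  · -- (1,0): hφ/den
    show DifferentiableAt ℝ (fun h' : ℝ => nambuPropagatorCT L M β μ h' K k 1 0) h ∧
      ‖deriv (fun h' : ℝ => nambuPropagatorCT L M β μ h' K k 1 0) h‖ ≤ |φ| / Λ ^ 2
    have H : HasDerivAt (fun h' : ℝ => nambuPropagatorCT L M β μ h' K k 1 0)
        ((((φ : ℝ) : ℂ) * (((D + (h * φ) ^ 2 : ℝ)) : ℂ) - ((h * φ : ℝ) : ℂ) * ((2 * h * φ ^ 2 : ℝ) : ℂ)) /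
          (((D + (h * φ) ^ 2 : ℝ)) : ℂ) ^ 2) h := by
      convert hasDerivAt_offDiag D φ h hDpos using 1
      funext h'
      rw [← hden h']
      simp [nambuPropagatorCT, hφ]
    refine ⟨H.differentiableAt, ?_⟩
    rw [H.deriv]
    exact offDiag_bound D φ h Λ hΛ hD
  · -- (1,1): (iω − e)/den
    show DifferentiableAt ℝ (fun h' : ℝ => nambuPropagatorCT L M β μ h' K k 1 1) h ∧
      ‖deriv (fun h' : ℝ => nambuPropagatorCT L M β μ h' K k 1 1) h‖ ≤ |φ| / Λ ^ 2
    have H : HasDerivAt (fun h' : ℝ => nambuPropagatorCT L M β μ h' K k 1 1)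
        (-((Complex.I * ω - e) * ((2 * h * φ ^ 2 : ℝ) : ℂ)) / (((D + (h * φ) ^ 2 : ℝ)) : ℂ) ^ 2) h := by
      convert hasDerivAt_diag (Complex.I * ω - e) D φ h hDpos using 1
      funext h'
      rw [← hden h']
      simp [nambuPropagatorCT, hω, he]
    refine ⟨H.differentiableAt, ?_⟩
    rw [H.deriv]
    exact diag_bound _ D φ h Λ hΛ hD (norm_sq_I_mul_sub ω e)


/-! ### S2 -/

theorem stub_seedConvolution_proof :
    ∀ (L M : ℕ) [NeZero L] (β U μ h h₀ : ℝ) (K : TrigPolyC4v) (Λ₀ : ℝ),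
      hubbardEffPartitionFnCT L M β U μ h₀ K Λ₀ ≠ 0 →
        hubbardEffectiveActionCT L M β U μ h K Λ₀ =
          effAction ℂ (hubbardCovAboveCT L M β μ h K Λ₀ - hubbardCovAboveCT L M β μ h₀ K Λ₀)
            (hubbardEffectiveActionCT L M β U μ h₀ K Λ₀) := by
  intro L M _ β U μ h h₀ K Λ₀ hZ
  rw [hubbardEffectiveActionCT_def, hubbardEffectiveActionCT_def,
    ← effAction_add ℂ _ _ _ (isUnit_iff_ne_zero.2 hZ), sub_add_cancel]


/-! ### S3 -/

/-- The statement of S1 (`stub_seedSliceBound`), verbatim. -/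
def SeedSliceBoundStmt : Prop :=
  ∀ (L M : ℕ) [NeZero L] (β μ Λ h : ℝ) (K : TrigPolyC4v) (k : FreqMomentum L M) (i j : Fin 2),
    0 < Λ → Λ ^ 2 ≤ matsubaraFreq β M k.1 ^ 2 + nambuXiCT L μ K k.2 ^ 2 →
      DifferentiableAt ℝ (fun h' : ℝ => nambuPropagatorCT L M β μ h' K k i j) h ∧
      ‖deriv (fun h' : ℝ => nambuPropagatorCT L M β μ h' K k i j) h‖ ≤ |dWaveSymbol L k.2| / Λ ^ 2

/-- `|φ_d| ≤ 4√2`. -/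
theorem abs_dWaveSymbol_le (L : ℕ) (k : TorusSite 2 L) : |dWaveSymbol L k| ≤ 4 * Real.sqrt 2 := by
  rw [dWaveSymbol, abs_mul, abs_mul, abs_of_pos two_pos, abs_of_nonneg (Real.sqrt_nonneg 2)]
  have h1 := Real.abs_cos_le_one (latticeMomentum L k 0)
  have h2 := Real.abs_cos_le_one (latticeMomentum L k 1)
  have h3 : |Real.cos (latticeMomentum L k 0) - Real.cos (latticeMomentum L k 1)| ≤ 2 :=
    (abs_sub _ _).trans (by linarith)
  calc 2 * Real.sqrt 2 * |Real.cos (latticeMomentum L k 0) - Real.cos (latticeMomentum L k 1)|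
      ≤ 2 * Real.sqrt 2 * 2 := by gcongr
    _ = 4 * Real.sqrt 2 := by ring

/-- `D(k) = ω(k)² + e_K(k⃗)²`, the quantity compared with `Λ²` by the cutoff and by S1. -/
def freqSq (L M : ℕ) (β μ : ℝ) (K : TrigPolyC4v) (k : FreqMomentum L M) : ℝ :=
  matsubaraFreq β M k.1 ^ 2 + nambuXiCT L μ K k.2 ^ 2

/-- `D(-k) = D(k)`. -/
theorem freqSq_neg {L M : ℕ} [NeZero L] (β μ : ℝ) (K : TrigPolyC4v) (k : FreqMomentum L M) :
    freqSq L M β μ K k.neg = freqSq L M β μ K k := by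
  simp only [freqSq, FreqMomentum.neg, matsubaraFreq_rev, neg_sq, nambuXiCT_neg]

/-- The Nambu relabelling does not change `D`. -/
theorem freqSq_toNambu {L M : ℕ} [NeZero L] (β μ : ℝ) (K : TrigPolyC4v) (X : HubbardFieldIdx L M) :
    freqSq L M β μ K (toNambu X).1.1 = freqSq L M β μ K X.1.1 := by
  unfold toNambu
  split_ifs with hσ
  · rfl
  · exact freqSq_neg β μ K X.1.1

/-- A nonzero CT weight forces `D > Λ₀²/4` (`χ₂ = 0` on `[0, ¼]`). -/
theorem freqSq_ge_of_weight_ne_zero {L M : ℕ} {β μ Λ₀ : ℝ} {K : TrigPolyC4v} (hΛ : 0 < Λ₀)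
    {k : FreqMomentum L M} (hw : hubbardCutoffWeightCT L M β μ K Λ₀ k ≠ 0) :
    (Λ₀ / 2) ^ 2 ≤ freqSq L M β μ K k := by
  by_contra hlt
  push Not at hlt
  apply hw
  rw [hubbardCutoffWeightCT]
  apply salmhoferCutoff_of_le
  rw [div_le_iff₀ (by positivity)]
  have : freqSq L M β μ K k = matsubaraFreq β M k.1 ^ 2 + nambuXiCT L μ K k.2 ^ 2 := rfl
  nlinarith

/-- One entry of the Nambu table: `‖T_h(A,B) − T_{h₀}(A,B)‖ ≤ 16√2·βL²·|h − h₀|/Λ₀²` above `Λ₀/2`. -/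
theorem nambuTwoPointCT_sub_bound (hS1 : SeedSliceBoundStmt) {L M : ℕ} [NeZero L] {β μ Λ₀ : ℝ}
    {K : TrigPolyC4v} (hβ : 0 < β) (hΛ : 0 < Λ₀) (h h₀ : ℝ) (A B : (FreqMomentum L M × Fin 2) × Fin 2)
    (hth : (Λ₀ / 2) ^ 2 ≤ freqSq L M β μ K A.1.1 ∨ (Λ₀ / 2) ^ 2 ≤ freqSq L M β μ K B.1.1) :
    ‖nambuTwoPointCT L M β μ h K A B - nambuTwoPointCT L M β μ h₀ K A B‖ ≤
      16 * Real.sqrt 2 * β * (L : ℝ) ^ 2 * |h - h₀| / Λ₀ ^ 2 := by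
  have hRHS : 0 ≤ 16 * Real.sqrt 2 * β * (L : ℝ) ^ 2 * |h - h₀| / Λ₀ ^ 2 := by positivity
  by_cases hc : A.2 = 1 ∧ B.2 = 0 ∧ A.1.1 = B.1.1
  · have hthA : (Λ₀ / 2) ^ 2 ≤ freqSq L M β μ K A.1.1 := by
      rcases hth with h1 | h1
      · exact h1
      · rw [hc.2.2]; exact h1
    simp only [nambuTwoPointCT, if_pos hc]
    rw [← mul_sub, norm_mul, Complex.norm_real, Real.norm_eq_abs, abs_of_nonneg (by positivity)]
    set f := fun h' : ℝ => nambuPropagatorCT L M β μ h' K A.1.1 A.1.2 B.1.2 with hf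
    have hmvt : ‖f h - f h₀‖ ≤ |dWaveSymbol L A.1.1.2| / (Λ₀ / 2) ^ 2 * ‖h - h₀‖ :=
      Convex.norm_image_sub_le_of_norm_deriv_le (s := Set.univ)
        (fun x _ => (hS1 L M β μ (Λ₀ / 2) x K A.1.1 A.1.2 B.1.2 (by positivity) hthA).1)
        (fun x _ => (hS1 L M β μ (Λ₀ / 2) x K A.1.1 A.1.2 B.1.2 (by positivity) hthA).2)
        convex_univ (Set.mem_univ h₀) (Set.mem_univ h)
    rw [Real.norm_eq_abs] at hmvt
    have hφ := abs_dWaveSymbol_le L A.1.1.2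
    calc β * (L : ℝ) ^ 2 * ‖f h - f h₀‖
        ≤ β * (L : ℝ) ^ 2 * (|dWaveSymbol L A.1.1.2| / (Λ₀ / 2) ^ 2 * |h - h₀|) := by gcongr
      _ ≤ β * (L : ℝ) ^ 2 * (4 * Real.sqrt 2 / (Λ₀ / 2) ^ 2 * |h - h₀|) := by gcongr
      _ = 16 * Real.sqrt 2 * β * (L : ℝ) ^ 2 * |h - h₀| / Λ₀ ^ 2 := by
          field_simp
          ring
  · simp only [nambuTwoPointCT, if_neg hc, sub_self, norm_zero]
    exact hRHS

/-- **S3 (`stub_seedSliceCovarianceBound`), proved** (with S1 as hypothesis, as filed). -/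
theorem stub_seedSliceCovarianceBound_proof :
    SeedSliceBoundStmt →
    ∀ (L M : ℕ) [NeZero L] (β μ h h₀ : ℝ) (K : TrigPolyC4v) (Λ₀ : ℝ) (X Y : HubbardFieldIdx L M),
      0 < β → 0 < Λ₀ →
        ‖hubbardCovAboveCT L M β μ h K Λ₀ X Y - hubbardCovAboveCT L M β μ h₀ K Λ₀ X Y‖ ≤
          32 * Real.sqrt 2 * β * (L : ℝ) ^ 2 * |h - h₀| / Λ₀ ^ 2 := by
  intro hS1 L M _ β μ h h₀ K Λ₀ X Y hβ hΛ
  have hRHS : 0 ≤ 32 * Real.sqrt 2 * β * (L : ℝ) ^ 2 * |h - h₀| / Λ₀ ^ 2 := by positivity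
  set wX := hubbardCutoffWeightCT L M β μ K Λ₀ (momentumOf L M X) with hwX
  set wY := hubbardCutoffWeightCT L M β μ K Λ₀ (momentumOf L M Y) with hwY
  have hw : hubbardCovAboveCT L M β μ h K Λ₀ X Y - hubbardCovAboveCT L M β μ h₀ K Λ₀ X Y =
      (((wX + wY) / 2 : ℝ) : ℂ) *
        (hubbardCovarianceCT L M β μ h K X Y - hubbardCovarianceCT L M β μ h₀ K X Y) := by
    simp only [hubbardCovAboveCT, Matrix.of_apply, hwX, hwY, mul_sub]
  rw [hw, norm_mul, Complex.norm_real, Real.norm_eq_abs]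
  have hX01 := salmhoferCutoff_mem_Icc
    ((matsubaraFreq β M (momentumOf L M X).1 ^ 2 + nambuXiCT L μ K (momentumOf L M X).2 ^ 2) / Λ₀ ^ 2)
  have hY01 := salmhoferCutoff_mem_Icc
    ((matsubaraFreq β M (momentumOf L M Y).1 ^ 2 + nambuXiCT L μ K (momentumOf L M Y).2 ^ 2) / Λ₀ ^ 2)
  change wX ∈ Set.Icc (0 : ℝ) 1 at hX01
  change wY ∈ Set.Icc (0 : ℝ) 1 at hY01
  have habs : |(wX + wY) / 2| ≤ 1 := by
    rw [abs_le]; constructor <;> linarith [hX01.1, hX01.2, hY01.1, hY01.2]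
  by_cases h0 : wX + wY = 0
  · rw [h0, zero_div, abs_zero, zero_mul]
    exact hRHS
  · -- some weight is nonzero: the common momentum is above `Λ₀/2`
    have hth : (Λ₀ / 2) ^ 2 ≤ freqSq L M β μ K X.1.1 ∨ (Λ₀ / 2) ^ 2 ≤ freqSq L M β μ K Y.1.1 := by
      by_cases hx : wX = 0
      · right
        have hy : wY ≠ 0 := fun hy => h0 (by rw [hx, hy, add_zero])
        exact freqSq_ge_of_weight_ne_zero hΛ hy
      · left
        exact freqSq_ge_of_weight_ne_zero hΛ hx
    have hthN : (Λ₀ / 2) ^ 2 ≤ freqSq L M β μ K (toNambu X).1.1 ∨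
        (Λ₀ / 2) ^ 2 ≤ freqSq L M β μ K (toNambu Y).1.1 := by
      rwa [freqSq_toNambu, freqSq_toNambu]
    have h1 := nambuTwoPointCT_sub_bound hS1 hβ hΛ h h₀ (toNambu X) (toNambu Y) hthN
    have h2 := nambuTwoPointCT_sub_bound hS1 hβ hΛ h h₀ (toNambu Y) (toNambu X) hthN.symm
    have hC : ‖hubbardCovarianceCT L M β μ h K X Y - hubbardCovarianceCT L M β μ h₀ K X Y‖ ≤
        ‖nambuTwoPointCT L M β μ h K (toNambu X) (toNambu Y) -
            nambuTwoPointCT L M β μ h₀ K (toNambu X) (toNambu Y)‖ +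
          ‖nambuTwoPointCT L M β μ h K (toNambu Y) (toNambu X) -
            nambuTwoPointCT L M β μ h₀ K (toNambu Y) (toNambu X)‖ := by
      simp only [hubbardCovarianceCT, Matrix.of_apply, hubbardTwoPointCT]
      set a := nambuTwoPointCT L M β μ h K (toNambu X) (toNambu Y)
      set b := nambuTwoPointCT L M β μ h K (toNambu Y) (toNambu X)
      set a₀ := nambuTwoPointCT L M β μ h₀ K (toNambu X) (toNambu Y)
      set b₀ := nambuTwoPointCT L M β μ h₀ K (toNambu Y) (toNambu X)
      calc ‖-(a - b) - -(a₀ - b₀)‖ = ‖(b - b₀) - (a - a₀)‖ := by congr 1; ring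
        _ ≤ ‖b - b₀‖ + ‖a - a₀‖ := norm_sub_le _ _
        _ = ‖a - a₀‖ + ‖b - b₀‖ := add_comm _ _
    calc |(wX + wY) / 2| * ‖hubbardCovarianceCT L M β μ h K X Y - hubbardCovarianceCT L M β μ h₀ K X Y‖
        ≤ 1 * (‖nambuTwoPointCT L M β μ h K (toNambu X) (toNambu Y) -
              nambuTwoPointCT L M β μ h₀ K (toNambu X) (toNambu Y)‖ +
            ‖nambuTwoPointCT L M β μ h K (toNambu Y) (toNambu X) -
              nambuTwoPointCT L M β μ h₀ K (toNambu Y) (toNambu X)‖) :=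
          mul_le_mul habs hC (norm_nonneg _) zero_le_one
      _ ≤ 1 * (16 * Real.sqrt 2 * β * (L : ℝ) ^ 2 * |h - h₀| / Λ₀ ^ 2 +
            16 * Real.sqrt 2 * β * (L : ℝ) ^ 2 * |h - h₀| / Λ₀ ^ 2) := by gcongr
      _ = 32 * Real.sqrt 2 * β * (L : ℝ) ^ 2 * |h - h₀| / Λ₀ ^ 2 := by ring


/-- **S3 unconditional**: S1 (proved above) discharges S3's hypothesis. -/
theorem stub_seedSliceCovarianceBound_unconditional :
    ∀ (L M : ℕ) [NeZero L] (β μ h h₀ : ℝ) (K : TrigPolyC4v) (Λ₀ : ℝ) (X Y : HubbardFieldIdx L M),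
      0 < β → 0 < Λ₀ →
        ‖hubbardCovAboveCT L M β μ h K Λ₀ X Y - hubbardCovAboveCT L M β μ h₀ K Λ₀ X Y‖ ≤
          32 * Real.sqrt 2 * β * (L : ℝ) ^ 2 * |h - h₀| / Λ₀ ^ 2 :=
  stub_seedSliceCovarianceBound_proof stub_seedSliceBound_proof

end Summit.HubbardSuperconductivity.HubbardSuperconductivity.Cruxes.SeededBrokenRegimeBoseFermiPinned.Drefute
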